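import Literature.NumberTheory.Li1992.RallisCoeffContinuous
import Literature.NumberTheory.Automorphic.AdelicPiSchwartzBruhatToLp
import Literature.NumberTheory.Weil1964.ArchDualPairL2Continuity
import HarnessLib

/-!
# Continuity of `h ↦ ⟨ω(h)Φ₁, Φ₂⟩` along Weil's sections: any continuous `s` with an archimedean covariant family, and the
# CM dual pair `U(diag d_V) × U(⟨d_W⟩)` (the `hcoef` binder of the E-2 letter DISCHARGED at the P4 consumer datum)

Topic `NumberTheory/Li1992`; namespace `Literature.NumberTheory.Li1992` (sequel of `RallisCoeffContinuous`).  KERNEL ONLY: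
proved theorems, no definition, no named fact, no `sorry`.

`RallisCoeffContinuous` reduces the continuity of the Weil-representation matrix coefficients of [Li1992, (25)] to the
strong `L²`-continuity of the orbit classes along a class map `i : 𝒮(𝔸_Fⁿ) →ₗ[ℂ] L²(𝔸_Fⁿ, ν)`.  This file plugs in the
tree's two PROVED strong-continuity theorems, at the class map `Automorphic.piSchwartzBruhatToLp` (`[Φ] = Φ` a.e.):

* §1 along a continuous homomorphism `s : H →* Mp_ψ(W_𝔸)ᶜᵒⁿᵗ` admitting an archimedean covariant family (the inputs of
  ★ `Weil1964.continuous_toL2_omega_comp`, i.e. Weil's Lemme 5 [Weil1964, Chap. III n° 41 p. 192]):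
  `continuous_schwartzPairing_omega_comp` (`_right`) — `h ↦ ⟨ω(s h)Φ₁, Φ₂⟩_ν` is continuous, unconditionally;
* §2 the CM dual pair over `L/L⁺` with its compatible splitting of record (`UnitaryDualPair.cmPairRep … hGR = pairRep
  (splittingOf hGR)`, hermitian LINE `W`, `V` of real rank `≤ 1` through `ι₁` and definite elsewhere — ★
  `Weil1964.continuous_toL2_omega_cmPairSplitting_of_signs_one`): **`continuous_schwartzPairing_cmPairRep_of_signs_one`**
  (two variables) and **`continuous_schwartzPairing_cmPairRep_one_of_signs_one`** (`h ↦ ⟨ω(s_pair(1,h))Φ₁, Φ₂⟩`) = the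
  binder `hcoef` of `Li1992.RallisInnerProductFormulaUnitaryDualPairRankOneCont` at the consumer datum of the P4 line
  (`s := splittingOf hGR₀`, `J_V = diag(frameD V)`, `J_W = diag(lineVec a₀)`), conditional only on [GelbartRogawski1991,
  Prop. 3.1.1] (`hGR`), like everything built on `splittingOf`.

## References
* [Li1992] J.-S. Li, J. reine angew. Math. 428 (1992) 177–217, p. 178, (25)–(26) p. 184.
* [Weil1964] A. Weil, Acta Math. 111 (1964) 143–211, Chap. III n° 39 p. 189, n° 41 Lemme 5 p. 192.
* [GelbartRogawski1991] S. Gelbart, J. Rogawski, Invent. Math. 105 (1991) 445–472, §3.1 p. 454 L21–27, Prop. 3.1.1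
  p. 455 L1–2.
-/

set_option autoImplicit false

noncomputable section

open scoped Matrix SchwartzMap Topology Classical ComplexConjugate InnerProductSpace
open NumberField NumberField.mixedEmbedding MeasureTheory

namespace Literature.NumberTheory.Li1992

open Literature.NumberTheory.Automorphic Literature.NumberTheory.Weil1964
open Literature.NumberTheory.GelbartRogawski1991
open Literature.RepresentationTheory.HeisenbergGroup Literature.Analysis.SegalBargmann

/-! ## §1 Along a continuous homomorphism with an archimedean covariant family (Weil's Lemme 5 inputs) -/

section Orbit

variable {F : Type} [Field F] [NumberField F] {n : ℕ}
  [MeasurableSpace (AdeleRing (𝓞 F) F)] [BorelSpace (AdeleRing (𝓞 F) F)]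
  (νX : Measure (Fin n → AdeleRing (𝓞 F) F)) [νX.IsAddHaarMeasure]
  {T : Matrix (Fin n) (Fin n) (AdeleRing (𝓞 F) F)}
  {H : Type*} [Group H] [TopologicalSpace H] [IsTopologicalGroup H] [FirstCountableTopology H]
  (hT : IsUnit T) (s : H →* adelicMpCont F (Fin n) T) (hs : Continuous s)
  (Winf : H → (𝓢((Fin n → mixedSpace F), ℂ) →L[ℂ] 𝓢((Fin n → mixedSpace F), ℂ)))
  (w0 : ∀ h, Winf h ≠ 0) (w1 : ∀ Φ, Continuous fun h => Winf h Φ)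
  (w2 : ∀ (h : H) (a w : Fin n → mixedSpace F) (Φ : 𝓢((Fin n → mixedSpace F), ℂ)),
    Winf h (archModTrans F (Fin n) T a w Φ) =
      weilPhase T (adelicMpCont.proj F (Fin n) T (s h)) (a, w) •
        archModTrans F (Fin n) T (archAct T (adelicMpCont.proj F (Fin n) T (s h)) (a, w)).1
          (archAct T (adelicMpCont.proj F (Fin n) T (s h)) (a, w)).2 (Winf h Φ))

include hT hs w0 w1 w2 in
/-- **`h ↦ ⟨ω(s h)Φ₁, Φ₂⟩_{ν_X}` is continuous along any continuous `s : H →* Mp_ψ(W_𝔸)ᶜᵒⁿᵗ` with an archimedean covariant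
family** (Weil's Lemme 5 ⇒ strong `L²`-continuity, ★ `continuous_toL2_omega_comp`, at the class map
`piSchwartzBruhatToLp`; then `RallisCoeffContinuous` §1).  Unconditional. [cite: Weil1964, Chap. III n° 41 Lemme 5 p. 192,
n° 39 p. 189; Li1992, (25) p. 184] -/
theorem continuous_schwartzPairing_omega_comp (Φ₁ Φ₂ : piSchwartzBruhat F (Fin n)) :
    Continuous fun h => schwartzPairing F (Fin n) νX (adelicMpCont.omega F (Fin n) T (s h) Φ₁) Φ₂ :=
  continuous_schwartzPairing_of_continuous_toLp F (Fin n) νX (piSchwartzBruhatToLp F (Fin n) νX)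
    (coeFn_piSchwartzBruhatToLp νX) (fun h => adelicMpCont.omega F (Fin n) T (s h) Φ₁)
    (continuous_toL2_omega_comp νX hT s hs Winf w0 w1 w2 (piSchwartzBruhatToLp F (Fin n) νX)
      (coeFn_piSchwartzBruhatToLp νX) Φ₁) Φ₂

include hT hs w0 w1 w2 in
/-- the conjugate-linear slot: `h ↦ ⟨Φ₂, ω(s h)Φ₁⟩_{ν_X}` is continuous. [cite: Weil1964, Chap. III n° 41 Lemme 5 p. 192;
Li1992, (25) p. 184] -/
theorem continuous_schwartzPairing_omega_comp_right (Φ₁ Φ₂ : piSchwartzBruhat F (Fin n)) :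
    Continuous fun h => schwartzPairing F (Fin n) νX Φ₂ (adelicMpCont.omega F (Fin n) T (s h) Φ₁) :=
  continuous_schwartzPairing_of_continuous_toLp_right F (Fin n) νX (piSchwartzBruhatToLp F (Fin n) νX)
    (coeFn_piSchwartzBruhatToLp νX) (fun h => adelicMpCont.omega F (Fin n) T (s h) Φ₁)
    (continuous_toL2_omega_comp νX hT s hs Winf w0 w1 w2 (piSchwartzBruhatToLp F (Fin n) νX)
      (coeFn_piSchwartzBruhatToLp νX) Φ₁) Φ₂

end Orbit

/-! ## §2 The CM dual pair `U(diag d_V) × U(⟨d_W⟩)` over `L/L⁺`: `hcoef` discharged at the consumer datum -/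

section CM

variable (L : Type) [Field L] [NumberField L] [IsCMField L]
  [MeasurableSpace (AdeleRing (𝓞 ↥(maximalRealSubfield L)) ↥(maximalRealSubfield L))]
  [BorelSpace (AdeleRing (𝓞 ↥(maximalRealSubfield L)) ↥(maximalRealSubfield L))]

/-- **matrix coefficients of the CM pair representation are continuous (hermitian LINE `W = ⟨d_W⟩`, `M = 1`)**: for `V` of
real rank `≤ 1` through `ι₁` (`h₁V`) and definite through every other complex embedding (`hV`), the compatible splitting of
record `cmPairSplitting … hGR` ([GelbartRogawski1991, Prop. 3.1.1], hypothesis `hGR`), every additive Haar measure `ν` on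
`𝔸ⁿ` and all `Φ₁ Φ₂`: `(u₁, u₂) ↦ ⟨ω(s_pair(u₁,u₂))Φ₁, Φ₂⟩_ν` is continuous on `U(diag d_V)(𝔸) × U(⟨d_W⟩)(𝔸)`
(★ `Weil1964.continuous_toL2_omega_cmPairSplitting_of_signs_one` + `RallisCoeffContinuous` §1). [cite: Weil1964, Chap. III
n° 41 Lemme 5 p. 192, n° 39 p. 189; GelbartRogawski1991, §3.1 Prop. 3.1.1 p. 455 L1–2; Li1992, (25) p. 184] -/
theorem continuous_schwartzPairing_cmPairRep_of_signs_one {N n : ℕ} (e : Fin N × Fin 1 ≃ Fin n)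
    (dV : Fin N → L) (hdV : ∀ i, IsCMField.complexConj L (dV i) = dV i) (hdV0 : ∀ i, dV i ≠ 0)
    (dW : Fin 1 → L) (hdW : ∀ i, IsCMField.complexConj L (dW i) = dW i) (hdW0 : ∀ i, dW i ≠ 0)
    (ν : Measure (Fin n → AdeleRing (𝓞 ↥(maximalRealSubfield L)) ↥(maximalRealSubfield L))) [ν.IsAddHaarMeasure]
    (ι₁ : L →+* ℂ)
    (hGR : (UnitaryDualPair.cmSplittingDatum L e dV hdV hdV0 dW hdW hdW0).CompatibleSplitting)
    (h₁V : ∃ i₀ : Fin N, (∀ i, i ≠ i₀ → 0 < (ι₁ (dV i)).re) ∨ ∀ i, i ≠ i₀ → (ι₁ (dV i)).re < 0)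
    (hV : ∀ τ : L →+* ℂ, InfinitePlace.mk τ ≠ InfinitePlace.mk ι₁ →
      (∀ i, 0 < (τ (dV i)).re) ∨ ∀ i, (τ (dV i)).re < 0)
    (Φ₁ Φ₂ : piSchwartzBruhat (↥(maximalRealSubfield L)) (Fin n)) :
    Continuous fun
      (p : ↥(UnitaryGroup.adelic (↥(maximalRealSubfield L)) L (IsCMField.complexConj L) N (Matrix.diagonal dV)) ×
        ↥(UnitaryGroup.adelic (↥(maximalRealSubfield L)) L (IsCMField.complexConj L) 1 (Matrix.diagonal dW))) =>
      schwartzPairing (↥(maximalRealSubfield L)) (Fin n) ν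
        (UnitaryDualPair.cmPairRep L e dV hdV hdV0 dW hdW hdW0 hGR p Φ₁) Φ₂ :=
  continuous_schwartzPairing_of_continuous_toLp (↥(maximalRealSubfield L)) (Fin n) ν
    (piSchwartzBruhatToLp (↥(maximalRealSubfield L)) (Fin n) ν)
    (coeFn_piSchwartzBruhatToLp ν)
    (fun p => UnitaryDualPair.cmPairRep L e dV hdV hdV0 dW hdW hdW0 hGR p Φ₁)
    (continuous_toL2_omega_cmPairSplitting_of_signs_one L e dV hdV hdV0 dW hdW hdW0 ν
      (piSchwartzBruhatToLp (↥(maximalRealSubfield L)) (Fin n) ν)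
      (coeFn_piSchwartzBruhatToLp ν) ι₁ hGR h₁V hV Φ₁) Φ₂

/-- **`hcoef` AT THE CONSUMER DATUM — `h ↦ ⟨ω(s_pair(1,h))Φ₁, Φ₂⟩_ν` is continuous on `U(⟨d_W⟩)(𝔸_{L⁺})`** for the pair
representation `pairRep (splittingOf hGR)` of the CM dual pair `U(diag d_V) × U(⟨d_W⟩)` (`= cmPairRep hGR` by definition),
`V` of real rank `≤ 1` through `ι₁` and definite elsewhere: the binder `hcoef` of
`Li1992.RallisInnerProductFormulaUnitaryDualPairRankOneCont` discharged where the P4 line consumes it (`s := splittingOf hGR₀`).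
[cite: Weil1964, Chap. III n° 41 Lemme 5 p. 192; GelbartRogawski1991, §3.1 Prop. 3.1.1 p. 455 L1–2; Li1992, (25)–(26)
p. 184] -/
theorem continuous_schwartzPairing_cmPairRep_one_of_signs_one {N n : ℕ} (e : Fin N × Fin 1 ≃ Fin n)
    (dV : Fin N → L) (hdV : ∀ i, IsCMField.complexConj L (dV i) = dV i) (hdV0 : ∀ i, dV i ≠ 0)
    (dW : Fin 1 → L) (hdW : ∀ i, IsCMField.complexConj L (dW i) = dW i) (hdW0 : ∀ i, dW i ≠ 0)
    (ν : Measure (Fin n → AdeleRing (𝓞 ↥(maximalRealSubfield L)) ↥(maximalRealSubfield L))) [ν.IsAddHaarMeasure]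
    (ι₁ : L →+* ℂ)
    (hGR : (UnitaryDualPair.cmSplittingDatum L e dV hdV hdV0 dW hdW hdW0).CompatibleSplitting)
    (h₁V : ∃ i₀ : Fin N, (∀ i, i ≠ i₀ → 0 < (ι₁ (dV i)).re) ∨ ∀ i, i ≠ i₀ → (ι₁ (dV i)).re < 0)
    (hV : ∀ τ : L →+* ℂ, InfinitePlace.mk τ ≠ InfinitePlace.mk ι₁ →
      (∀ i, 0 < (τ (dV i)).re) ∨ ∀ i, (τ (dV i)).re < 0)
    (Φ₁ Φ₂ : piSchwartzBruhat (↥(maximalRealSubfield L)) (Fin n)) :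
    Continuous fun h : ↥(UnitaryGroup.adelic (↥(maximalRealSubfield L)) L (IsCMField.complexConj L) 1 (Matrix.diagonal dW)) =>
      schwartzPairing (↥(maximalRealSubfield L)) (Fin n) ν
        (UnitaryDualPair.pairRep (↥(maximalRealSubfield L)) L (IsCMField.complexConj L) N 1 e (Matrix.diagonal dV)
          (Matrix.diagonal dW)
          (UnitaryDualPair.splittingOf (↥(maximalRealSubfield L)) L (IsCMField.complexConj L) N 1 e (Matrix.diagonal dV)
            (Matrix.diagonal dW) (UnitaryDualPair.complexConj_imagUnit L) (UnitaryDualPair.imagUnit_ne_zero L)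
            (UnitaryDualPair.imagUnit_mul_self L) (UnitaryDualPair.realDiagonal_isSymm L dV hdV)
            (UnitaryDualPair.realDiagonal_isSymm L dW hdW) (UnitaryDualPair.isUnit_det_realDiagonal L dV hdV hdV0)
            (UnitaryDualPair.isUnit_det_realDiagonal L dW hdW hdW0) (UnitaryDualPair.realDiagonal_map L dV hdV).symm
            (UnitaryDualPair.realDiagonal_map L dW hdW).symm hGR)
          (1, h) Φ₁) Φ₂ :=
  (continuous_schwartzPairing_cmPairRep_of_signs_one L e dV hdV hdV0 dW hdW hdW0 ν ι₁ hGR h₁V hV Φ₁ Φ₂).comp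
    (Continuous.prodMk continuous_const continuous_id)

end CM

end Literature.NumberTheory.Li1992

end
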